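import Mathlib
import HarnessLib
import Literature.Analysis.FluidPDE.SpaceTimeCalculus
import Literature.Analysis.FluidPDE.KNSSLemma31Caloric
import Literature.Analysis.FluidPDE.FirstIntegralTransportDefect
import Literature.Analysis.FluidPDE.DivFreeVectorPotential

/-!
# Route `UnthreadedDoor`, crux `PoloidalLiouville` (stmt-NavierStokesRegularity-1222), WALL W1 `stub_scalarLiouville` —
# crux idea «capsym-comparison» (ns-idea-13 g0), line input FL-C `CapSym.ZonalToroidalLiouville`: `∂ₜ` AND `Δ` COMMUTE WITH `U ↦ ∇U × x`

KEY-NS #150 (2) / DIRECTOR-NS #246 (4), step (1) of the FL-C handoff plan (`FLC-HANDOFF.md`, evidence on 1222): the two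
commutations left there.  With `B = ∇U × x`:

* `CapSym.cross_gradient_eq_curlCLM_smulRight` — `∇f(x) × a = curlCLM (Df(x) ⊗ a)`: `B` is a FIXED continuous linear function
  of the slice derivative `DU`, which is what makes both commutations one-liners over the tree's calculus;
* `CapSym.hasDerivAt_cross_gradient_slice`, `CapSym.deriv_cross_gradient_slice` — **`∂ₜ(∇U × x) = ∇(∂ₜU) × x`** for `U` jointly
  smooth on `]−∞,0[ × ℝ³` (`IsSmoothSpaceTimeOn (Iio 0) U` = FL-C's `ContDiffOn ℝ ∞ (uncurry U) (Iio 0 ×ˢ univ)`), `t < 0`, via the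
  exchange lemma `IsSmoothSpaceTimeOn.hasDerivAt_fderiv_slice_clm`;
* `CapSym.laplacian_self_eq_zero` (`Δ id = 0`), `CapSym.sum_curlCLM_smulRight_hessian_eq_zero` (Schwarz kills
  `Σᵢ curlCLM (D²U eᵢ ⊗ eᵢ)`), and **`CapSym.laplacian_cross_gradient` — `Δ(∇U × x) = ∇(ΔU) × x`** for `U ∈ C³(ℝ³)`, by the
  Leibniz rule for pairings `laplacian_clm_apply_of_contDiffAt` with `c = K ∘ DU` (`K ℓ a = curlCLM (ℓ ⊗ a)`), `v = id`,
  `laplacian_CLM_comp_left` and `laplacian_fderiv_eq_fderiv_laplacian`.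

With `…CapSymZonalToroidalInductionAlgebra` (p652350: curl of the potential form + the transport–stretching algebra) these close
step (1) up to bookkeeping: `∂ₜB + DB[V] − DV[B] = ΔB` for `B t = ∇U(t) × x` follows from the potential-form equation.

WHAT THIS IS NOT: no NS-regularity statement is touched; FL-C is NOT proved here (remaining: the bookkeeping assembly of the
induction equation, the `ℝ⁵` lift + `KNSSMaxPrincipleR5` — see `FLC-HANDOFF.md`); `PoloidalLiouville` (1222), its wall and the
summit stay OPEN.  `--supports stmt-NavierStokesRegularity-1222 --as helper`.
[cite: Evans2010, App. C.1 (exchange of derivatives)] [cite: MajdaBertozziCUP2002, §1.1 (vector identities)]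
-/

noncomputable section

-- the summit and its single sub-problem share the name (CONVENTIONS §1)
set_option linter.dupNamespace false

open Set Function Filter Topology InnerProductSpace
open scoped RealInnerProductSpace ContDiff

namespace Summit.NavierStokesRegularity.NavierStokesRegularity.Theorems.PoloidalLiouville.CapSym

open Literature.Analysis Literature.Analysis.FluidPDE

/-- `∇f(x) × a = curlCLM (Df(x) ⊗ a)` (`curlCLM_smulRight` read with `(toDual)⁻¹ Df(x) = ∇f(x)`). [folklore] -/
theorem cross_gradient_eq_curlCLM_smulRight (f : EuclideanSpace ℝ (Fin 3) → ℝ) (x a : EuclideanSpace ℝ (Fin 3)) :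
    cross (gradient f x) a = curlCLM ((fderiv ℝ f x).smulRight a) := by
  rw [curlCLM_smulRight]
  rfl

/-- **`∂ₜ(∇U × x) = ∇(∂ₜU) × x`** (`HasDerivAt` form): for `U` jointly smooth on `]−∞,0[ × ℝ³` and `t < 0`, the time line
`s ↦ ∇U(s)(x) × x` has derivative `∇(∂ₜU(t,·))(x) × x` at `t`. [cite: Evans2010, App. C.1] -/
theorem hasDerivAt_cross_gradient_slice {U : ℝ → EuclideanSpace ℝ (Fin 3) → ℝ}
    (hU : IsSmoothSpaceTimeOn (Iio 0) U) {t : ℝ} (ht : t < 0) (x : EuclideanSpace ℝ (Fin 3)) :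
    HasDerivAt (fun s => cross (gradient (U s) x) x)
      (cross (gradient (fun y => deriv (fun s => U s y) t) x) x) t := by
  -- the fixed continuous linear map `ℓ ↦ curlCLM (ℓ ⊗ x)`
  set Λ : (EuclideanSpace ℝ (Fin 3) →L[ℝ] ℝ) →L[ℝ] EuclideanSpace ℝ (Fin 3) :=
    curlCLM.comp ((ContinuousLinearMap.smulRightL ℝ (EuclideanSpace ℝ (Fin 3)) (EuclideanSpace ℝ (Fin 3))).flip x)
    with hΛ
  have hΛapply : ∀ ℓ : EuclideanSpace ℝ (Fin 3) →L[ℝ] ℝ, Λ ℓ = curlCLM (ℓ.smulRight x) := fun ℓ => by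
    simp only [hΛ, ContinuousLinearMap.coe_comp, Function.comp_apply, ContinuousLinearMap.flip_apply]
    rfl
  have h1 := hU.hasDerivAt_fderiv_slice_clm isOpen_Iio ht x
  have h2 := (Λ.hasFDerivAt).comp_hasDerivAt t h1
  have e1 : (Λ ∘ fun s => fderiv ℝ (U s) x) = fun s => cross (gradient (U s) x) x := by
    funext s
    simp only [Function.comp_apply, hΛapply, cross_gradient_eq_curlCLM_smulRight]
  rw [e1, hΛapply, ← cross_gradient_eq_curlCLM_smulRight] at h2
  exact h2

/-- **`∂ₜ(∇U × x) = ∇(∂ₜU) × x`** (`deriv` form). [cite: Evans2010, App. C.1] -/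
theorem deriv_cross_gradient_slice {U : ℝ → EuclideanSpace ℝ (Fin 3) → ℝ}
    (hU : IsSmoothSpaceTimeOn (Iio 0) U) {t : ℝ} (ht : t < 0) (x : EuclideanSpace ℝ (Fin 3)) :
    deriv (fun s => cross (gradient (U s) x) x) t = cross (gradient (fun y => deriv (fun s => U s y) t) x) x :=
  (hasDerivAt_cross_gradient_slice hU ht x).deriv

/-! ### The Laplacian -/

/-- `Δ (y ↦ y) = 0` on `ℝ³`. [folklore] -/
theorem laplacian_self_eq_zero (x : EuclideanSpace ℝ (Fin 3)) :
    Laplacian.laplacian (fun y : EuclideanSpace ℝ (Fin 3) => y) x = 0 := by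
  have e : (fun y : EuclideanSpace ℝ (Fin 3) => y) = (ContinuousLinearMap.id ℝ (EuclideanSpace ℝ (Fin 3)) : _ → _) := rfl
  rw [e, laplacian_eq_sum_fderiv_fderiv (stdOrthonormalBasis ℝ (EuclideanSpace ℝ (Fin 3)))
    (ContinuousLinearMap.id ℝ (EuclideanSpace ℝ (Fin 3))).contDiff x]
  simp

/-- **Schwarz kills the mixed term**: `Σᵢ curlCLM (D²U(x) eᵢ ⊗ eᵢ) = 0` for `U ∈ C²` (`eᵢ` the standard basis; the
curl of the rank-one maps built from the symmetric Hessian cancels in pairs). [folklore] -/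
theorem sum_curlCLM_smulRight_hessian_eq_zero {U : EuclideanSpace ℝ (Fin 3) → ℝ} (hU : ContDiff ℝ 2 U)
    (x : EuclideanSpace ℝ (Fin 3)) :
    ∑ i : Fin 3, curlCLM ((fderiv ℝ (fderiv ℝ U) x (EuclideanSpace.single i (1 : ℝ))).smulRight
      (EuclideanSpace.single i (1 : ℝ))) = 0 := by
  have hS : IsSymmSndFDerivAt ℝ U x := hU.contDiffAt.isSymmSndFDerivAt (by simp)
  have h01 := hS.eq (EuclideanSpace.single 0 (1 : ℝ)) (EuclideanSpace.single 1 (1 : ℝ))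
  have h02 := hS.eq (EuclideanSpace.single 0 (1 : ℝ)) (EuclideanSpace.single 2 (1 : ℝ))
  have h12 := hS.eq (EuclideanSpace.single 1 (1 : ℝ)) (EuclideanSpace.single 2 (1 : ℝ))
  simp only [Fin.sum_univ_three, curlCLM_apply, ContinuousLinearMap.smulRight_apply]
  ext k
  fin_cases k <;> simp [h01, h02, h12]

set_option maxHeartbeats 400000 in
/-- **`Δ(∇U × x) = ∇(ΔU) × x`** for `U ∈ C³(ℝ³)`. [cite: MajdaBertozziCUP2002, §1.1 (vector identities)] -/
theorem laplacian_cross_gradient {U : EuclideanSpace ℝ (Fin 3) → ℝ} (hU : ContDiff ℝ 3 U)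
    (x : EuclideanSpace ℝ (Fin 3)) :
    Laplacian.laplacian (fun y : EuclideanSpace ℝ (Fin 3) => cross (gradient U y) y) x =
      cross (gradient (Laplacian.laplacian U) x) x := by
  -- the fixed continuous linear map `K ℓ a = curlCLM (ℓ ⊗ a)`
  set K : (EuclideanSpace ℝ (Fin 3) →L[ℝ] ℝ) →L[ℝ] (EuclideanSpace ℝ (Fin 3) →L[ℝ] EuclideanSpace ℝ (Fin 3)) :=
    (ContinuousLinearMap.compL ℝ (EuclideanSpace ℝ (Fin 3)) (EuclideanSpace ℝ (Fin 3) →L[ℝ] EuclideanSpace ℝ (Fin 3))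
      (EuclideanSpace ℝ (Fin 3)) curlCLM).comp
      (ContinuousLinearMap.smulRightL ℝ (EuclideanSpace ℝ (Fin 3)) (EuclideanSpace ℝ (Fin 3))) with hK
  have hKapply : ∀ (ℓ : EuclideanSpace ℝ (Fin 3) →L[ℝ] ℝ) (a : EuclideanSpace ℝ (Fin 3)),
      K ℓ a = curlCLM (ℓ.smulRight a) := fun ℓ a => by
    simp only [hK, ContinuousLinearMap.coe_comp, Function.comp_apply, ContinuousLinearMap.compL_apply]
    rfl
  set c : EuclideanSpace ℝ (Fin 3) → (EuclideanSpace ℝ (Fin 3) →L[ℝ] EuclideanSpace ℝ (Fin 3)) :=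
    fun y => K (fderiv ℝ U y) with hc
  have hB : (fun y : EuclideanSpace ℝ (Fin 3) => cross (gradient U y) y) =
      fun y => c y ((fun z : EuclideanSpace ℝ (Fin 3) => z) y) := by
    funext y
    simp only [hc, hKapply]
    exact cross_gradient_eq_curlCLM_smulRight U y y
  -- regularity
  have hDU : ContDiff ℝ 2 (fderiv ℝ U) := hU.fderiv_right (m := 2) (by norm_cast)
  have hcC : ContDiff ℝ 2 c := K.contDiff.comp hDU
  have hid : ContDiff ℝ 2 (fun z : EuclideanSpace ℝ (Fin 3) => z) := contDiff_id
  rw [hB, laplacian_clm_apply_of_contDiffAt (EuclideanSpace.basisFun (Fin 3) ℝ) hcC.contDiffAt hid.contDiffAt]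
  -- (T3) `Δ id = 0`
  have hT3 : Laplacian.laplacian (fun z : EuclideanSpace ℝ (Fin 3) => z) x = 0 := laplacian_self_eq_zero x
  -- (T1) `Δ c = K (D ΔU)`
  have hT1 : Laplacian.laplacian c x = K (fderiv ℝ (Laplacian.laplacian U) x) := by
    have h := hDU.contDiffAt.laplacian_CLM_comp_left (l := K) (x := x)
    rw [Function.comp_apply, laplacian_fderiv_eq_fderiv_laplacian hU x] at h
    exact h
  -- (T2) the mixed term vanishes
  have hDc : ∀ w : EuclideanSpace ℝ (Fin 3), fderiv ℝ c x w = K (fderiv ℝ (fderiv ℝ U) x w) := fun w => by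
    have h := (K.hasFDerivAt.comp x ((hDU.differentiable (by simp)) x).hasFDerivAt).fderiv
    rw [show c = (K : _ → _) ∘ fderiv ℝ U from rfl, h]
    rfl
  have hT2 : ∑ i : Fin 3, (fderiv ℝ c x (EuclideanSpace.basisFun (Fin 3) ℝ i))
      (fderiv ℝ (fun z : EuclideanSpace ℝ (Fin 3) => z) x (EuclideanSpace.basisFun (Fin 3) ℝ i)) = 0 := by
    have hfid : fderiv ℝ (fun z : EuclideanSpace ℝ (Fin 3) => z) x = ContinuousLinearMap.id ℝ _ := fderiv_id
    simp only [hfid, ContinuousLinearMap.id_apply, EuclideanSpace.basisFun_apply, hDc, hKapply]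
    exact sum_curlCLM_smulRight_hessian_eq_zero (hU.of_le (by norm_cast)) x
  rw [hT1, hT2, hT3, hKapply, smul_zero, add_zero, map_zero, add_zero]
  exact (cross_gradient_eq_curlCLM_smulRight _ x x).symm

end Summit.NavierStokesRegularity.NavierStokesRegularity.Theorems.PoloidalLiouville.CapSym

end
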